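import Mathlib
-- import Summits.ValiantsHypothesis.ValiantsHypothesis.Theses.UlrichPadded  -- farm olean stale (2026-08-16); signature mirrored below
import Literature.Computability.AlgebraicComplexity.DeterminantalComplexity
import Literature.Computability.AlgebraicComplexity.LandsbergRessayreNormalForm

/-!
# Sketch (ideator 2, crux-ideate round 1) for crux `UlrichPadded.OrbitCorankTwo`
(stmt-ValiantsHypothesis-15032).  First lemmas of the three idea cards; statements only
(`sorry`), they must elaborate.

* card `levelled-limit-bb-cell`      : `infinitesimal_transitivity`, `levelledLimit_isAffineDetRepr`
* card `kernel-syzygy-untwist`       : `adjugate_linPart_mul_constPart_mulVec_kernel`,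
                                        `untwist_isAffineDetRepr`
* card `jacobian-propagation-vertex` : `graphChart_bijective`, `orbitCorankTwo_of_bassRange`
-/

namespace Summit.ValiantsHypothesis.ValiantsHypothesis.Cruxes.OrbitCorankTwo.Ideator2

open MvPolynomial Matrix
open Literature.Computability.AlgebraicComplexity

noncomputable section

variable {n m : ℕ}

/-- linear part of an affine matrix (entrywise degree-1 homogeneous component). -/
def linPart (A : Matrix (Fin m) (Fin m) (MvPolynomial (Fin n × Fin n) ℂ)) :
    Matrix (Fin m) (Fin m) (MvPolynomial (Fin n × Fin n) ℂ) :=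
  Matrix.of fun a b => homogeneousComponent 1 (A a b)

/-- constant part, re-embedded as a matrix of constant polynomials. -/
def constPartC (A : Matrix (Fin m) (Fin m) (MvPolynomial (Fin n × Fin n) ℂ)) :
    Matrix (Fin m) (Fin m) (MvPolynomial (Fin n × Fin n) ℂ) :=
  (constPart A).map C

/-! ### Card `levelled-limit-bb-cell` -/

/-- **Infinitesimal transitivity of the polynomial gauge** (first lemma of card
`levelled-limit-bb-cell`; a theorem modulo tree results `rankOneTrivialisation_proof`,
`permHypersurfaceFactorial_proof`): for `n ≥ 3` and an affine determinantal representation `A` of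
`per_n`, every polynomial matrix `δ` tangent to `{det = per_n}` modulo `per_n`
(`tr (adj A · δ) ∈ (per_n)`) is an infinitesimal gauge transformation `δ = X·A + A·Y` with
POLYNOMIAL `X, Y`.  Proof sketch: `adj A ≡ c wᵀ (mod per)`, `c̄, w̄` unimodular over
`S = ℂ[x]/(per)` (coker A ≅ S by factoriality), `im Ā = ker w̄ᵀ` (matrix-factorisation
exactness); `w̄ᵀ δ c̄ = 0` gives `δ c̄ = Ā ū`, put `Y := u vᵀ` with `vᵀ c ≡ 1`, then
`X := (δ - A Y) · adj A / per` is polynomial. -/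
theorem infinitesimal_transitivity (hn : 3 ≤ n)
    (A : Matrix (Fin m) (Fin m) (MvPolynomial (Fin n × Fin n) ℂ))
    (hA : IsAffineDetRepr (perPoly (Fin n) ℂ) A)
    (δ : Matrix (Fin m) (Fin m) (MvPolynomial (Fin n × Fin n) ℂ))
    (hδ : (A.adjugate * δ).trace ∈ Ideal.span {perPoly (Fin n) ℂ}) :
    ∃ X Y : Matrix (Fin m) (Fin m) (MvPolynomial (Fin n × Fin n) ℂ), δ = X * A + A * Y := by
  sorry

/-- The one-parameter torus family `λ ↦ diag(λ^α) · A(λ·x) · diag(λ^β)` used for the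
Hilbert–Mumford / Białynicki-Birula degeneration to a LEVELLED representation: for integer weights
with `α i + β j ≥ 0` on the support of the constant part, `α i + β j ≥ -1` on the support of the
linear part and `∑ α + ∑ β = -n`, every member (λ ≠ 0) is again an affine determinantal
representation of `per_n` (so the flat limit `λ → 0`, which keeps exactly the entries of tight
weight, is a levelled representation in the closure of the scaling-class of `A`).  Stated for the
members; weights are realised through `zpow` on the unit `λ`. -/
theorem levelledFamily_isAffineDetRepr (hn : 1 ≤ n)
    (A : Matrix (Fin m) (Fin m) (MvPolynomial (Fin n × Fin n) ℂ))
    (hA : IsAffineDetRepr (perPoly (Fin n) ℂ) A) (α β : Fin m → ℤ)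
    (hsum : ∑ i, α i + ∑ j, β j = -(n : ℤ)) (t : ℂˣ) :
    IsAffineDetRepr (perPoly (Fin n) ℂ)
      (Matrix.diagonal (fun i => C ((t : ℂ) ^ (α i))) *
        A.map (fun p => aeval (fun v : Fin n × Fin n => C (t : ℂ) * X v) p) *
        Matrix.diagonal (fun j => C ((t : ℂ) ^ (β j)))) := by
  sorry

/-! ### Card `kernel-syzygy-untwist` -/

/-- **Pairing obstruction vanishes** (first lemma of card `kernel-syzygy-untwist`): for an affine
matrix `A = A₀ + L` whose determinant has no components of degree `m-1` and `m` (e.g. `det A = per_n`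
with `n + 2 ≤ m`), the degree-`(m-1)` part of `adj(A)·A = det A · 1` gives
`adj(L)·A₀ = -[adj A]_{m-2}·L`, hence `adj(L)·A₀` kills every kernel vector of `L`. -/
theorem adjugate_linPart_mul_constPart_mulVec_kernel (hm : n + 2 ≤ m)
    (A : Matrix (Fin m) (Fin m) (MvPolynomial (Fin n × Fin n) ℂ))
    (hA : IsAffineDetRepr (perPoly (Fin n) ℂ) A)
    (c : Fin m → MvPolynomial (Fin n × Fin n) ℂ) (hc : (linPart A).mulVec c = 0) :
    ((linPart A).adjugate * constPartC A).mulVec c = 0 := by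
  sorry

/-- **The untwist is an affine representation**: a LINEAR kernel vector `c` of the linear part
(`L c = 0`, entries homogeneous of degree 1) and a constant vector `e` with `eᵀ c = 0` give the
unipotent polynomial gauge `Q = 1 + c eᵀ` (`Q⁻¹ = 1 - c eᵀ`, `det Q = 1`) with
`A · Q = A + A₀ c eᵀ` again affine with determinant `per_n`. -/
theorem untwist_isAffineDetRepr
    (A : Matrix (Fin m) (Fin m) (MvPolynomial (Fin n × Fin n) ℂ))
    (hA : IsAffineDetRepr (perPoly (Fin n) ℂ) A)
    (c : Fin m → MvPolynomial (Fin n × Fin n) ℂ) (hc1 : ∀ i, (c i).IsHomogeneous 1)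
    (hc : (linPart A).mulVec c = 0) (e : Fin m → ℂ) (he : ∑ i, C (e i) * c i = 0) :
    IsAffineDetRepr (perPoly (Fin n) ℂ) (A * (1 + Matrix.of fun i j => c i * C (e j))) := by
  sorry

/-! ### Card `jacobian-propagation-vertex` -/

/-- variables of the `(i,j)`-chart: all `x_{kl}` with `(k,l) ≠ (i,j)`. -/
abbrev ChartVars (n : ℕ) (i j : Fin n) : Type := {p : Fin n × Fin n // p ≠ (i, j)}

/-- the `(i,j)`-subpermanent `P_ij = ∂ per_n / ∂ x_ij`, written in the chart variables
(it does not involve `x_ij`). -/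
def subPer (n : ℕ) (i j : Fin (n + 1)) : MvPolynomial (ChartVars (n + 1) i j) ℂ :=
  (Matrix.of fun k l : Fin n =>
      (X ⟨(i.succAbove k, j.succAbove l), by
          intro h
          exact (Fin.succAbove_ne i k) (Prod.mk.inj h).1⟩ :
        MvPolynomial (ChartVars (n + 1) i j) ℂ)).permanent

/-- the permanental hypersurface ring `S = ℂ[x]/(per)`. -/
abbrev PerRing (n : ℕ) : Type :=
  MvPolynomial (Fin n × Fin n) ℂ ⧸ Ideal.span {perPoly (Fin n) ℂ}

/-- the chart map `ℂ[x_{kl} : (k,l) ≠ (i,j)] → S`. -/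
def chartHom (n : ℕ) (i j : Fin n) : MvPolynomial (ChartVars n i j) ℂ →ₐ[ℂ] PerRing n :=
  (Ideal.Quotient.mkₐ ℂ _).comp (rename (Subtype.val : ChartVars n i j → Fin n × Fin n))

/-- **Graph chart** (first lemma of card `jacobian-propagation-vertex`): since `per` is linear in
`x_ij` with coefficient `P_ij`, on `P_ij ≠ 0` the hypersurface is the graph
`x_ij = -(per - x_ij P_ij)/P_ij`; algebraically, the chart map induces an ISOMORPHISM
`ℂ[x_{kl} : (k,l) ≠ (i,j)][1/P_ij] ≅ S[1/P̄_ij]`.  In particular `S[1/P̄_ij]` is a localised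
POLYNOMIAL ring (smooth, and a polynomial ring in the `2n` cross variables over
`ℂ[minor][1/P_ij]`), which is what makes Suslin's monic calculus / Fasel's
homotopy-implies-elementary theorem available on the subpermanent charts. -/
theorem graphChart_bijective (n : ℕ) (hn : 2 ≤ n) (i j : Fin (n + 1)) :
    Function.Bijective
      (IsLocalization.Away.lift (subPer n i j)
        (g := (algebraMap (PerRing (n + 1))
            (Localization.Away (chartHom (n + 1) i j (subPer n i j)))).comp
              (chartHom (n + 1) i j).toRingHom)
        (by
          simpa using IsLocalization.Away.algebraMap_isUnit
            (S := Localization.Away (chartHom (n + 1) i j (subPer n i j)))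
            (chartHom (n + 1) i j (subPer n i j))) :
        Localization.Away (subPer n i j) →+*
          Localization.Away (chartHom (n + 1) i j (subPer n i j))) := by
  sorry

/-- **Bass-range case of the crux** (refuter F3, recorded as the provable base of the line):
for `m ≥ n² + 1` the gauge orbit is the whole fibre (`E_m(S)` transitive on `Um_m(S)`,
`sr S ≤ dim S + 1 = n²`) and `A'' ⊕ 1` supplies a corank-two member. -/
theorem orbitCorankTwo_of_bassRange (hn : 3 ≤ n) (hm : n ^ 2 + 1 ≤ m)
    (A : Matrix (Fin m) (Fin m) (MvPolynomial (Fin n × Fin n) ℂ))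
    (hA : IsAffineDetRepr (perPoly (Fin n) ℂ) A) :
    ∃ P Q : Matrix (Fin m) (Fin m) (MvPolynomial (Fin n × Fin n) ℂ), IsUnit P ∧ IsUnit Q ∧
      IsAffineDetRepr (perPoly (Fin n) ℂ) (P * A * Q) ∧
      ∀ i j, (linPart (P * A * Q)).adjugate i j ∈ Ideal.span {perPoly (Fin n) ℂ} := by
  sorry

/-- Verbatim mirror of the ledger signature of `UlrichPadded.OrbitCorankTwo`
(stmt-ValiantsHypothesis-15032).  (The farm olean of `Theses/UlrichPadded.lean` predates the
2026-08-16 items, so the route constant is not importable on the farm yet — same workaround as the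
refuter's Probe.lean; the decl in the tree file is fine.) -/
def OrbitCorankTwoMirror : Prop :=
  ∀ n : ℕ, 3 ≤ n → ∀ (m : ℕ) (A : Matrix (Fin m) (Fin m) (MvPolynomial (Fin n × Fin n) ℂ)), Literature.Computability.AlgebraicComplexity.IsAffineDetRepr (Literature.Computability.AlgebraicComplexity.perPoly (Fin n) ℂ) A → ∃ P Q : Matrix (Fin m) (Fin m) (MvPolynomial (Fin n × Fin n) ℂ), IsUnit P ∧ IsUnit Q ∧ Literature.Computability.AlgebraicComplexity.IsAffineDetRepr (Literature.Computability.AlgebraicComplexity.perPoly (Fin n) ℂ) (P * A * Q) ∧ ∀ i j, (Matrix.of fun a b => MvPolynomial.homogeneousComponent 1 ((P * A * Q) a b)).adjugate i j ∈ Ideal.span {Literature.Computability.AlgebraicComplexity.perPoly (Fin n) ℂ}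

/-- sanity: the crux (mirrored) from a per-size statement in this file's notation
(`linPart` unfolds to the signature's `Matrix.of fun a b => homogeneousComponent 1 _`). -/
theorem orbitCorankTwo_of_forall
    (h : ∀ n : ℕ, 3 ≤ n → ∀ (m : ℕ) (A : Matrix (Fin m) (Fin m) (MvPolynomial (Fin n × Fin n) ℂ)),
      IsAffineDetRepr (perPoly (Fin n) ℂ) A →
      ∃ P Q : Matrix (Fin m) (Fin m) (MvPolynomial (Fin n × Fin n) ℂ), IsUnit P ∧ IsUnit Q ∧
        IsAffineDetRepr (perPoly (Fin n) ℂ) (P * A * Q) ∧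
        ∀ i j, (linPart (P * A * Q)).adjugate i j ∈ Ideal.span {perPoly (Fin n) ℂ}) :
    OrbitCorankTwoMirror := by
  intro n hn m A hA
  exact h n hn m A hA

end

end Summit.ValiantsHypothesis.ValiantsHypothesis.Cruxes.OrbitCorankTwo.Ideator2
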